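import Literature.Probability.Percolation.FourArmGarbanRevealment
import Literature.Probability.Percolation.FiniteEnergy
import HarnessLib

/-!
# Garban's "nondiagonal terms vanish": orthogonality of revealed bits for the medial exploration

Topic `Literature/Probability/Percolation`; support file for the named fact
`Garban2011_fourArm_multiscale` (`FourArmGarban.lean`; C. Garban, Appendix B of O. Schramm,
S. Smirnov, Ann. Probab. 39 (2011), Lemma B.1). Bond percolation on `ℤ²`; the interface is the
tree's medial exploration of an admissible discrete Dobrushin domain, in the orbit formalism of
`MedialInterfaceProofs.lean` / `FKExplorationDomainMarkov.lean` (prefix events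
`explorationCylinder`, orbit locality).

Garban (proof of Lemma B.1, after (B.8)), verbatim: "In the last sum, nondiagonal terms vanish.
Indeed, let `i ≠ j` and stop the interface `γ` the first time it touched both squares `Q_i` and
`Q_j`, or when it ends. Denote by `Q_k` the first square of `Q_i`, `Q_j` to be hit (or `Q_i` if
none was) and by `Q_l` the other one [...]. Let `W` be the percolation configuration in the
immediate neighborhood of the interface so far, and in `Q_k`. Then `W` determines `Y_i`, `Y_j`,
`C_k`, while being independent of `C_l`. Thus by the identity in (B.3),
`E[C_i Y_i C_j Y_j | W] = E[Y_i Y_j C_k | W] · E[C_l] = 0`. By the total expectation formula we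
conclude that, for `i ≠ j`, `E[C_i Y_i C_j Y_j] = 0`."

This file proves that sentence for the tree's objects, for two "blocks" given by disjoint edge
sets `E₁`, `E₂` (the edges of `Q_i`, `Q_j`; revealment `Y = 1_{Reveals hD E}`,
`FourArmGarbanRevealment.lean`) and bits `C = 1_O - 1_Δ` whose events `O`, `Δ` are determined
by disjoint sets of pairs `F₁`, `F₂` with every domain edge of `F_k` in `E_k`, and have equal
probabilities (`E[C] = 0`; for Garban's circuit bits this is `FourArmGarbanCircuitBits.lean`):

* `FirstVisitAfter hD E' E n`, `VisitsBefore hD E' E` — "`Q_k` hit first, `Q_l` first hit at time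
  `n`"; `reveals_inter_reveals_eq_union` — `{Y_i = Y_j = 1}` is the disjoint union of the two
  orders;
* `visitAtom` — the atoms `W`: configurations in `FirstVisitAfter` with a prescribed orbit
  prefix; each nonempty atom is a prefix event `explorationCylinder hD ω₀ n`, determined by the
  explored edges `e_i(ω₀)`, `i < n` (`determinedBy_explorationCylinder`), which avoid `F_l`;
* `measure_visitAtom_inter_inter`, `measure_visitsBefore_inter_inter` — **independence of `W`
  (and of the bit of the first block) from the events of the block hit last**:
  `P(W ∩ S ∩ X) = P(W ∩ S) · P(X)` (`bondPercolation_inter_of_disjoint`), summed over the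
  countably many atoms;
* `integral_indicator_reveals_mul_eq_zero` — **`E[C₁ Y₁ C₂ Y₂] = 0`**, the field `orthogonal` of
  `GarbanScheme` (`FourArmGarbanAssembly.lean`).

All events built from the exploration are determined by the finitely many edges of the discrete
domain, hence measurable (`measurableSet_of_bcInvariant`).

## References

* O. Schramm, S. Smirnov (appendix by C. Garban), Ann. Probab. 39 (2011), Appendix B, proof of
  Lemma B.1 (after (B.8)) [SchrammSmirnov2011].
* H. Duminil-Copin, S. Smirnov, Clay Math. Proc. 15 (2012), §6.2, proof of Lemma 6.6 (the
  prefix events of the exploration) [DuminilCopinSmirnov2012Clay].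

Tree: `Reveals` (`FourArmGarbanRevealment.lean`), `explorationCylinder`,
`mem_explorationCylinder_iff`, `mem_explorationCylinder_iff_free`,
`min_succ_exitTime_eq_of_mem_explorationCylinder`, `exploredEdge`, `exploredEdge_mem_edgeSet`,
`IsFreeEdge` (`FKExplorationDomainMarkov.lean`), `cornerOrbit`, `startCorner`, `exitTime`,
`exitTime_eq_of`, `not_isInnerFace_exitTime`, `isInnerFace_of_lt_exitTime`, `bcBondConfig`,
`meshDomain_finite`, `DeterminedBy`, `determinedBy_iff`, `DeterminedBy.mono`, `DeterminedBy.inter`,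
`DeterminedBy.measurableSet_of_finset` (`PercolationEvents.lean`),
`bondPercolation_inter_of_disjoint` (`FiniteEnergy.lean`).
-/

noncomputable section

namespace Literature.Probability.Percolation

open _root_.MeasureTheory Set LatticeModels LatticeModels.DiscreteDobrushin

variable {D : DiscreteDobrushin}

/-! ### Everything the exploration sees is read off the edges of the discrete domain -/

/-- The completed configuration depends only on the states of the edges of the discrete domain.
[cite: Smirnov2001, §2] -/
theorem bcBondConfig_eq_of_inter_eq {ω ω' : BondConfig (Site 2)}
    (h : ω ∩ (discreteDomainGraph D.Ω D.δ).edgeSet = ω' ∩ (discreteDomainGraph D.Ω D.δ).edgeSet) :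
    D.bcBondConfig ω = D.bcBondConfig ω' := by
  ext e
  simp only [mem_bcBondConfig_iff]
  have key : e ∈ (discreteDomainGraph D.Ω D.δ).edgeSet → (e ∈ ω ↔ e ∈ ω') := fun he =>
    ⟨fun hω => ((Set.ext_iff.1 h e).1 ⟨hω, he⟩).1, fun hω => ((Set.ext_iff.1 h e).2 ⟨hω, he⟩).1⟩
  constructor
  · rintro ⟨he, h'⟩
    exact ⟨he, by rwa [← key he]⟩
  · rintro ⟨he, h'⟩
    exact ⟨he, by rwa [key he]⟩

/-- The exit time depends only on the completed configuration. [cite: Smirnov2001, §2] -/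
theorem exitTime_congr (hD : D.IsZdAdmissible) {ω ω' : BondConfig (Site 2)}
    (h : D.bcBondConfig ω = D.bcBondConfig ω') : exitTime hD ω = exitTime hD ω' := by
  apply exitTime_eq_of hD ω
  · rw [h]; exact not_isInnerFace_exitTime hD ω'
  · intro k hk; rw [h]; exact isInnerFace_of_lt_exitTime hD ω' hk

/-- The explored edges depend only on the completed configuration. [cite: Smirnov2001, §2] -/
theorem exploredEdge_congr (hD : D.IsZdAdmissible) {ω ω' : BondConfig (Site 2)}
    (h : D.bcBondConfig ω = D.bcBondConfig ω') (i : ℕ) :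
    exploredEdge hD ω i = exploredEdge hD ω' i := by
  unfold exploredEdge; rw [h]

/-- An event whose membership depends only on the completed configuration is determined by the
edges of the discrete domain. [folklore] -/
theorem determinedBy_of_bcInvariant {A : Set (BondConfig (Site 2))}
    (hA : ∀ ω ω' : BondConfig (Site 2), D.bcBondConfig ω = D.bcBondConfig ω' → (ω ∈ A ↔ ω' ∈ A)) :
    DeterminedBy A (discreteDomainGraph D.Ω D.δ).edgeSet := by
  rw [determinedBy_iff]
  exact fun ω ω' h => hA ω ω' (bcBondConfig_eq_of_inter_eq h)

/-- The discrete domain of admissible (bounded, positive-mesh) data has finitely many edges.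
[folklore] -/
theorem finite_edgeSet_discreteDomainGraph (hD : D.IsZdAdmissible) :
    ((discreteDomainGraph D.Ω D.δ).edgeSet).Finite := by
  have hfin := meshDomain_finite hD.isBounded hD.delta_pos
  have hsub : (discreteDomainGraph D.Ω D.δ).edgeSet ⊆
      (fun q : Site 2 × Site 2 => s(q.1, q.2)) '' (meshDomain D.Ω D.δ ×ˢ meshDomain D.Ω D.δ) := by
    intro e he
    induction e using Sym2.ind with
    | h x y =>
      have hadj := (SimpleGraph.mem_edgeSet _).1 he
      obtain ⟨-, hx, hy⟩ := discreteDomainGraph_adj_iff.1 hadj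
      exact ⟨(x, y), ⟨hx, hy⟩, rfl⟩
  exact ((hfin.prod hfin).image _).subset hsub

/-- An event read off the completed configuration is measurable (it is determined by the finitely
many edges of the discrete domain). [folklore] -/
theorem measurableSet_of_bcInvariant (hD : D.IsZdAdmissible) {A : Set (BondConfig (Site 2))}
    (hA : ∀ ω ω' : BondConfig (Site 2), D.bcBondConfig ω = D.bcBondConfig ω' → (ω ∈ A ↔ ω' ∈ A)) :
    MeasurableSet A := by
  have h := determinedBy_of_bcInvariant hA
  rw [← (finite_edgeSet_discreteDomainGraph hD).coe_toFinset] at h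
  exact h.measurableSet_of_finset

/-- The revealment event is read off the completed configuration. [folklore] -/
theorem reveals_bcInvariant (hD : D.IsZdAdmissible) (E : Set (Sym2 (Site 2)))
    (ω ω' : BondConfig (Site 2)) (h : D.bcBondConfig ω = D.bcBondConfig ω') :
    ω ∈ Reveals hD E ↔ ω' ∈ Reveals hD E := by
  simp only [mem_reveals_iff, exitTime_congr hD h, exploredEdge_congr hD h]

/-- The revealment event is measurable. [folklore] -/
theorem measurableSet_reveals (hD : D.IsZdAdmissible) (E : Set (Sym2 (Site 2))) :
    MeasurableSet (Reveals hD E) :=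
  measurableSet_of_bcInvariant hD (reveals_bcInvariant hD E)

/-! ### Who is hit first -/

/-- **`Q_k` hit first, `Q_l` first hit at time `n`** (Garban: "Denote by `Q_k` the first square
to be hit and by `Q_l` the other one"): the exploration of `ω` arrives at an edge of `E` for the
first time at time `n < exitTime`, having arrived at an edge of `E'` before. [cite: SchrammSmirnov2011, Appendix B, proof of Lemma B.1 (nondiagonal terms)] -/
def FirstVisitAfter (hD : D.IsZdAdmissible) (E' E : Set (Sym2 (Site 2))) (n : ℕ) :
    Set (BondConfig (Site 2)) :=
  {ω | n < exitTime hD ω ∧ exploredEdge hD ω n ∈ E ∧ (∀ i < n, exploredEdge hD ω i ∉ E) ∧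
    ∃ i < n, exploredEdge hD ω i ∈ E'}

/-- **`Q_k` hit before `Q_l`**: the union over the first hitting time of `E`. [cite: SchrammSmirnov2011, Appendix B, proof of Lemma B.1 (nondiagonal terms)] -/
def VisitsBefore (hD : D.IsZdAdmissible) (E' E : Set (Sym2 (Site 2))) : Set (BondConfig (Site 2)) :=
  ⋃ n, FirstVisitAfter hD E' E n

/-- `FirstVisitAfter` is read off the completed configuration. [folklore] -/
theorem firstVisitAfter_bcInvariant (hD : D.IsZdAdmissible) (E' E : Set (Sym2 (Site 2))) (n : ℕ)
    (ω ω' : BondConfig (Site 2)) (h : D.bcBondConfig ω = D.bcBondConfig ω') :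
    ω ∈ FirstVisitAfter hD E' E n ↔ ω' ∈ FirstVisitAfter hD E' E n := by
  simp only [FirstVisitAfter, mem_setOf_eq, exitTime_congr hD h, exploredEdge_congr hD h]

/-- `FirstVisitAfter` is measurable. [folklore] -/
theorem measurableSet_firstVisitAfter (hD : D.IsZdAdmissible) (E' E : Set (Sym2 (Site 2)))
    (n : ℕ) : MeasurableSet (FirstVisitAfter hD E' E n) :=
  measurableSet_of_bcInvariant hD (firstVisitAfter_bcInvariant hD E' E n)

/-- `VisitsBefore` is measurable. [folklore] -/
theorem measurableSet_visitsBefore (hD : D.IsZdAdmissible) (E' E : Set (Sym2 (Site 2))) :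
    MeasurableSet (VisitsBefore hD E' E) :=
  MeasurableSet.iUnion fun n => measurableSet_firstVisitAfter hD E' E n

/-- The first hitting time is unique: the events `FirstVisitAfter … n` are pairwise disjoint in
`n`. [folklore] -/
theorem disjoint_firstVisitAfter (hD : D.IsZdAdmissible) (E' E : Set (Sym2 (Site 2))) {n n' : ℕ}
    (h : n ≠ n') : Disjoint (FirstVisitAfter hD E' E n) (FirstVisitAfter hD E' E n') := by
  rw [Set.disjoint_left]
  rintro ω ⟨-, hn, hbef, -⟩ ⟨-, hn', hbef', -⟩
  rcases lt_or_gt_of_ne h with hlt | hlt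
  · exact hbef' n hlt hn
  · exact hbef n' hlt hn'

/-- **The two orders partition `{Y_i = Y_j = 1}`**: if `E₁` and `E₂` are disjoint, a
configuration whose exploration reaches both reaches one of them first. [cite: SchrammSmirnov2011, Appendix B, proof of Lemma B.1 (nondiagonal terms)] -/
theorem reveals_inter_reveals_eq_union (hD : D.IsZdAdmissible) {E₁ E₂ : Set (Sym2 (Site 2))}
    (hE : Disjoint E₁ E₂) :
    Reveals hD E₁ ∩ Reveals hD E₂ = VisitsBefore hD E₁ E₂ ∪ VisitsBefore hD E₂ E₁ := by
  classical
  ext ω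
  simp only [mem_inter_iff, mem_reveals_iff, VisitsBefore, mem_iUnion, mem_union]
  constructor
  · rintro ⟨h₁, h₂⟩
    -- first hitting times `Nat.find h₁`, `Nat.find h₂`
    obtain ⟨hn₁lt, hn₁E⟩ := Nat.find_spec h₁
    obtain ⟨hn₂lt, hn₂E⟩ := Nat.find_spec h₂
    have hmin₁ : ∀ i < Nat.find h₁, exploredEdge hD ω i ∉ E₁ := fun i hi hiE =>
      Nat.find_min h₁ hi ⟨hi.trans hn₁lt, hiE⟩
    have hmin₂ : ∀ i < Nat.find h₂, exploredEdge hD ω i ∉ E₂ := fun i hi hiE =>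
      Nat.find_min h₂ hi ⟨hi.trans hn₂lt, hiE⟩
    have hne : Nat.find h₁ ≠ Nat.find h₂ := by
      intro h
      have h' := hn₁E
      rw [h] at h'
      exact Set.disjoint_left.1 hE h' hn₂E
    rcases lt_or_gt_of_ne hne with hlt | hlt
    · exact Or.inl ⟨_, hn₂lt, hn₂E, hmin₂, _, hlt, hn₁E⟩
    · exact Or.inr ⟨_, hn₁lt, hn₁E, hmin₁, _, hlt, hn₂E⟩
  · rintro (⟨n, hn, hnE, -, i, hi, hiE⟩ | ⟨n, hn, hnE, -, i, hi, hiE⟩)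
    · exact ⟨⟨i, hi.trans hn, hiE⟩, ⟨n, hn, hnE⟩⟩
    · exact ⟨⟨n, hn, hnE⟩, ⟨i, hi.trans hn, hiE⟩⟩

/-- The two orders are exclusive. [folklore] -/
theorem disjoint_visitsBefore (hD : D.IsZdAdmissible) (E₁ E₂ : Set (Sym2 (Site 2))) :
    Disjoint (VisitsBefore hD E₁ E₂) (VisitsBefore hD E₂ E₁) := by
  rw [Set.disjoint_left]
  intro ω h h'
  simp only [VisitsBefore, mem_iUnion] at h h'
  obtain ⟨n, -, hnE, hbef, i, hi, hiE⟩ := h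
  obtain ⟨n', -, hn'E, hbef', i', hi', hi'E⟩ := h'
  -- `E₂` is first hit at `n`, but `i' < n'` hits `E₂`, and `E₁` is first hit at `n'` while `i < n` hits it
  have h1 : n ≤ i' := le_of_not_gt fun h => hbef i' h hi'E
  have h2 : n' ≤ i := le_of_not_gt fun h => hbef' i h hiE
  omega

/-! ### The atoms `W`: prefix events inside `FirstVisitAfter` -/

/-- **The atom with prescribed orbit prefix** (Garban's `W`: "the percolation configuration in
the immediate neighborhood of the interface so far"): the configurations of
`FirstVisitAfter hD E' E n` whose orbit of the turning rule has the prescribed corners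
`π 0, …, π n`. [cite: SchrammSmirnov2011, Appendix B, proof of Lemma B.1 (nondiagonal terms)] -/
def visitAtom (hD : D.IsZdAdmissible) (E' E : Set (Sym2 (Site 2))) (n : ℕ)
    (π : Fin (n + 1) → Site 2 × Fin 4) : Set (BondConfig (Site 2)) :=
  {ω ∈ FirstVisitAfter hD E' E n |
    ∀ i : Fin (n + 1), cornerOrbit (D.bcBondConfig ω) (startCorner hD) i = π i}

/-- `FirstVisitAfter` is the union of its atoms. [folklore] -/
theorem firstVisitAfter_eq_iUnion_visitAtom (hD : D.IsZdAdmissible) (E' E : Set (Sym2 (Site 2)))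
    (n : ℕ) : FirstVisitAfter hD E' E n = ⋃ π, visitAtom hD E' E n π := by
  ext ω
  simp only [visitAtom, mem_iUnion, mem_setOf_eq]
  exact ⟨fun h => ⟨fun i => cornerOrbit (D.bcBondConfig ω) (startCorner hD) i, h, fun _ => rfl⟩,
    fun ⟨_, h, _⟩ => h⟩

/-- Distinct prefixes give disjoint atoms. [folklore] -/
theorem disjoint_visitAtom (hD : D.IsZdAdmissible) (E' E : Set (Sym2 (Site 2))) (n : ℕ)
    {π π' : Fin (n + 1) → Site 2 × Fin 4} (h : π ≠ π') :
    Disjoint (visitAtom hD E' E n π) (visitAtom hD E' E n π') := by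
  rw [Set.disjoint_left]
  rintro ω ⟨-, hπ⟩ ⟨-, hπ'⟩
  exact h (funext fun i => (hπ i).symm.trans (hπ' i))

/-- **A nonempty atom is a prefix event** of the exploration (`explorationCylinder`): on
`FirstVisitAfter … n` the exit time exceeds `n`, so prescribing the corners `0, …, n` is the
prefix relation at depth `n`, and conversely the prefix event of a member stays inside
`FirstVisitAfter … n` (explored edges and the truncated exit time are constant on it).
[cite: DuminilCopinSmirnov2012Clay, §6.2, proof of Lemma 6.6] -/
theorem visitAtom_eq_explorationCylinder (hD : D.IsZdAdmissible) {E' E : Set (Sym2 (Site 2))}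
    {n : ℕ} {π : Fin (n + 1) → Site 2 × Fin 4} {ω₀ : BondConfig (Site 2)}
    (h₀ : ω₀ ∈ visitAtom hD E' E n π) : visitAtom hD E' E n π = explorationCylinder hD ω₀ n := by
  obtain ⟨⟨hn₀, hE₀, hbef₀, i₀, hi₀, hi₀E⟩, hπ₀⟩ := h₀
  have hmin : min n (exitTime hD ω₀) = n := min_eq_left hn₀.le
  ext ω
  constructor
  · rintro ⟨-, hπ⟩
    rw [mem_explorationCylinder_iff]
    intro i hi
    rw [hmin] at hi
    have h1 := hπ ⟨i, Nat.lt_succ_of_le hi⟩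
    have h2 := hπ₀ ⟨i, Nat.lt_succ_of_le hi⟩
    exact h1.trans h2.symm
  · intro hω
    have horb : ∀ i ≤ n, cornerOrbit (D.bcBondConfig ω) (startCorner hD) i =
        cornerOrbit (D.bcBondConfig ω₀) (startCorner hD) i := fun i hi =>
      (mem_explorationCylinder_iff.1 hω) i (by rw [hmin]; exact hi)
    have hedge : ∀ i ≤ n, exploredEdge hD ω i = exploredEdge hD ω₀ i := fun i hi =>
      congrArg cTgt (horb i hi)
    have hexit : n < exitTime hD ω := by
      have := min_succ_exitTime_eq_of_mem_explorationCylinder hω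
      have h2 : min (n + 1) (exitTime hD ω₀) = n + 1 := min_eq_left hn₀
      omega
    refine ⟨⟨hexit, ?_, fun i hi => ?_, i₀, hi₀, ?_⟩, fun i => ?_⟩
    · rw [hedge n le_rfl]; exact hE₀
    · rw [hedge i hi.le]; exact hbef₀ i hi
    · rw [hedge i₀ hi₀.le]; exact hi₀E
    · rw [horb i (Nat.le_of_lt_succ i.isLt)]; exact hπ₀ i

/-- Atoms are measurable. [folklore] -/
theorem measurableSet_visitAtom (hD : D.IsZdAdmissible) (E' E : Set (Sym2 (Site 2))) (n : ℕ)
    (π : Fin (n + 1) → Site 2 × Fin 4) : MeasurableSet (visitAtom hD E' E n π) := by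
  refine measurableSet_of_bcInvariant hD fun ω ω' h => ?_
  simp only [visitAtom, mem_setOf_eq, firstVisitAfter_bcInvariant hD E' E n ω ω' h, h]

/-- **A prefix event is determined by its free explored edges** (orbit locality,
`mem_explorationCylinder_iff_free`). [cite: DuminilCopinSmirnov2012Clay, §6.2, proof of Lemma 6.6] -/
theorem determinedBy_explorationCylinder (hD : D.IsZdAdmissible) (ω₀ : BondConfig (Site 2)) (n : ℕ) :
    DeterminedBy (explorationCylinder hD ω₀ n)
      {e | ∃ i < min n (exitTime hD ω₀), D.IsFreeEdge (exploredEdge hD ω₀ i) ∧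
        e = exploredEdge hD ω₀ i} := by
  rw [determinedBy_iff]
  intro ω ω' h
  rw [mem_explorationCylinder_iff_free, mem_explorationCylinder_iff_free]
  refine forall₂_congr fun i hi => forall_congr' fun hf => ?_
  have hmem : exploredEdge hD ω₀ i ∈ {e | ∃ i < min n (exitTime hD ω₀),
      D.IsFreeEdge (exploredEdge hD ω₀ i) ∧ e = exploredEdge hD ω₀ i} := ⟨i, hi, hf, rfl⟩
  have key : exploredEdge hD ω₀ i ∈ ω ↔ exploredEdge hD ω₀ i ∈ ω' :=
    ⟨fun hω => ((Set.ext_iff.1 h _).1 ⟨hω, hmem⟩).1, fun hω => ((Set.ext_iff.1 h _).2 ⟨hω, hmem⟩).1⟩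
  rw [key]

/-! ### Independence on the atoms -/

/-- **`W` is independent of the block hit last** (Garban: "`W` determines `Y_i`, `Y_j`, `C_k`,
while being independent of `C_l`"): on an atom of `FirstVisitAfter hD E' E n`, intersected with
an event `S` determined by a set of pairs `F₁`, every event `X` determined by a set of pairs `F₂`
disjoint from `F₁` and containing no domain edge outside `E` is independent:
`P(W ∩ S ∩ X) = P(W ∩ S) · P(X)`. (The atom is a prefix event, determined by explored edges of
times `< n`, which are domain edges off `E`, hence off `F₂`.) [cite: SchrammSmirnov2011, Appendix B, proof of Lemma B.1 (nondiagonal terms)] -/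
theorem measure_visitAtom_inter_inter (hD : D.IsZdAdmissible) (p : unitInterval)
    {E' E : Set (Sym2 (Site 2))} {n : ℕ} {π : Fin (n + 1) → Site 2 × Fin 4}
    {F₁ F₂ : Set (Sym2 (Site 2))} (hF : Disjoint F₁ F₂)
    (hFE : ∀ e ∈ F₂, e ∈ (discreteDomainGraph D.Ω D.δ).edgeSet → e ∈ E)
    {S X : Set (BondConfig (Site 2))} (hS : DeterminedBy S F₁) (hSm : MeasurableSet S)
    (hX : DeterminedBy X F₂) (hXm : MeasurableSet X) :
    bondPercolation (zdGraph 2) p (visitAtom hD E' E n π ∩ S ∩ X) =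
      bondPercolation (zdGraph 2) p (visitAtom hD E' E n π ∩ S) *
        bondPercolation (zdGraph 2) p X := by
  rcases (visitAtom hD E' E n π).eq_empty_or_nonempty with h0 | ⟨ω₀, h₀⟩
  · simp [h0]
  · have hatom := visitAtom_eq_explorationCylinder hD h₀
    obtain ⟨⟨-, -, hbef₀, -⟩, -⟩ := h₀
    set T : Set (Sym2 (Site 2)) := {e | ∃ i < min n (exitTime hD ω₀),
      D.IsFreeEdge (exploredEdge hD ω₀ i) ∧ e = exploredEdge hD ω₀ i} with hTdef
    have hT : DeterminedBy (visitAtom hD E' E n π) T := by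
      rw [hatom]; exact determinedBy_explorationCylinder hD ω₀ n
    have hTF : Disjoint T F₂ := by
      rw [Set.disjoint_left]
      rintro e ⟨i, hi, -, rfl⟩ heF
      have hi' : i < n := lt_of_lt_of_le hi (min_le_left _ _)
      have hiN : i < exitTime hD ω₀ := lt_of_lt_of_le hi (min_le_right _ _)
      exact hbef₀ i hi' (hFE _ heF (exploredEdge_mem_edgeSet hiN))
    have hdisj : Disjoint (T ∪ F₁) F₂ := Set.disjoint_union_left.2 ⟨hTF, hF⟩
    have hAS : DeterminedBy (visitAtom hD E' E n π ∩ S) (T ∪ F₁) :=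
      (hT.mono subset_union_left).inter (hS.mono subset_union_right)
    exact bondPercolation_inter_of_disjoint (zdGraph 2) p hdisj hAS hX
      ((measurableSet_visitAtom hD E' E n π).inter hSm) hXm

/-- **Total expectation over the atoms**: the same product formula for the whole event "`E'` hit
before `E`" (countably many disjoint measurable atoms, indexed by the first hitting time and
the orbit prefix). [cite: SchrammSmirnov2011, Appendix B, proof of Lemma B.1 (nondiagonal terms, total expectation)] -/
theorem measure_visitsBefore_inter_inter (hD : D.IsZdAdmissible) (p : unitInterval)
    {E' E : Set (Sym2 (Site 2))} {F₁ F₂ : Set (Sym2 (Site 2))} (hF : Disjoint F₁ F₂)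
    (hFE : ∀ e ∈ F₂, e ∈ (discreteDomainGraph D.Ω D.δ).edgeSet → e ∈ E)
    {S X : Set (BondConfig (Site 2))} (hS : DeterminedBy S F₁) (hSm : MeasurableSet S)
    (hX : DeterminedBy X F₂) (hXm : MeasurableSet X) :
    bondPercolation (zdGraph 2) p (VisitsBefore hD E' E ∩ S ∩ X) =
      bondPercolation (zdGraph 2) p (VisitsBefore hD E' E ∩ S) *
        bondPercolation (zdGraph 2) p X := by
  set P := bondPercolation (zdGraph 2) p with hP
  set f : (Σ n : ℕ, (Fin (n + 1) → Site 2 × Fin 4)) → Set (BondConfig (Site 2)) :=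
    fun q => visitAtom hD E' E q.1 q.2 with hf
  have hunion : VisitsBefore hD E' E = ⋃ q, f q := by
    ext ω
    simp only [VisitsBefore, mem_iUnion, hf, firstVisitAfter_eq_iUnion_visitAtom]
    constructor
    · rintro ⟨n, π, h⟩; exact ⟨⟨n, π⟩, h⟩
    · rintro ⟨⟨n, π⟩, h⟩; exact ⟨n, π, h⟩
  have hdisj : Pairwise (Function.onFun Disjoint f) := by
    rintro ⟨n, π⟩ ⟨n', π'⟩ hne
    by_cases hn : n = n'
    · subst hn
      have hπ : π ≠ π' := fun h => hne (by subst h; rfl)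
      exact disjoint_visitAtom hD E' E n hπ
    · refine Set.disjoint_left.2 fun ω h h' => ?_
      exact Set.disjoint_left.1 (disjoint_firstVisitAfter hD E' E hn) h.1 h'.1
  have hmeas : ∀ q, MeasurableSet (f q) := fun q => measurableSet_visitAtom hD E' E q.1 q.2
  have hdisj₂ : Pairwise (Function.onFun Disjoint fun q => f q ∩ S ∩ X) := fun q q' hne =>
    (hdisj hne).mono (inter_subset_left.trans inter_subset_left)
      (inter_subset_left.trans inter_subset_left)
  have hdisj₁ : Pairwise (Function.onFun Disjoint fun q => f q ∩ S) := fun q q' hne =>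
    (hdisj hne).mono inter_subset_left inter_subset_left
  calc P (VisitsBefore hD E' E ∩ S ∩ X) = P (⋃ q, f q ∩ S ∩ X) := by
        rw [hunion, iUnion_inter, iUnion_inter]
    _ = ∑' q, P (f q ∩ S ∩ X) :=
        measure_iUnion hdisj₂ fun q => ((hmeas q).inter hSm).inter hXm
    _ = ∑' q, P (f q ∩ S) * P X := by
        congr 1; funext q
        exact measure_visitAtom_inter_inter hD p hF hFE hS hSm hX hXm
    _ = (∑' q, P (f q ∩ S)) * P X := ENNReal.tsum_mul_right
    _ = P (⋃ q, f q ∩ S) * P X := by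
        rw [measure_iUnion hdisj₁ fun q => (hmeas q).inter hSm]
    _ = P (VisitsBefore hD E' E ∩ S) * P X := by rw [hunion, iUnion_inter]

/-- Real-valued form of `measure_visitsBefore_inter_inter`. [cite: SchrammSmirnov2011, Appendix B, proof of Lemma B.1 (nondiagonal terms)] -/
theorem measureReal_visitsBefore_inter_inter (hD : D.IsZdAdmissible) (p : unitInterval)
    {E' E : Set (Sym2 (Site 2))} {F₁ F₂ : Set (Sym2 (Site 2))} (hF : Disjoint F₁ F₂)
    (hFE : ∀ e ∈ F₂, e ∈ (discreteDomainGraph D.Ω D.δ).edgeSet → e ∈ E)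
    {S X : Set (BondConfig (Site 2))} (hS : DeterminedBy S F₁) (hSm : MeasurableSet S)
    (hX : DeterminedBy X F₂) (hXm : MeasurableSet X) :
    (bondPercolation (zdGraph 2) p).real (VisitsBefore hD E' E ∩ S ∩ X) =
      (bondPercolation (zdGraph 2) p).real (VisitsBefore hD E' E ∩ S) *
        (bondPercolation (zdGraph 2) p).real X := by
  simp only [measureReal_def]
  rw [measure_visitsBefore_inter_inter hD p hF hFE hS hSm hX hXm, ENNReal.toReal_mul]

/-! ### `E[C₁ Y₁ C₂ Y₂] = 0` -/

/-- The product of two revealed bits, expanded into indicators. [folklore] -/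
theorem indicator_bit_mul_indicator_bit (R₁ R₂ O₁ Δ₁ O₂ Δ₂ : Set (BondConfig (Site 2)))
    (ω : BondConfig (Site 2)) :
    R₁.indicator (fun ω => O₁.indicator (1 : BondConfig (Site 2) → ℝ) ω - Δ₁.indicator 1 ω) ω *
      R₂.indicator (fun ω => O₂.indicator (1 : BondConfig (Site 2) → ℝ) ω - Δ₂.indicator 1 ω) ω =
    (R₁ ∩ R₂ ∩ (O₁ ∩ O₂)).indicator 1 ω - (R₁ ∩ R₂ ∩ (O₁ ∩ Δ₂)).indicator 1 ω -
      (R₁ ∩ R₂ ∩ (Δ₁ ∩ O₂)).indicator 1 ω + (R₁ ∩ R₂ ∩ (Δ₁ ∩ Δ₂)).indicator 1 ω := by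
  by_cases hR₁ : ω ∈ R₁ <;> by_cases hR₂ : ω ∈ R₂ <;> by_cases hO₁ : ω ∈ O₁ <;>
    by_cases hΔ₁ : ω ∈ Δ₁ <;> by_cases hO₂ : ω ∈ O₂ <;> by_cases hΔ₂ : ω ∈ Δ₂ <;>
    simp [hR₁, hR₂, hO₁, hΔ₁, hO₂, hΔ₂]

/-- **"Nondiagonal terms vanish"** (Schramm–Smirnov 2011, App. B, proof of Lemma B.1): for two
blocks with disjoint edge sets `E₁`, `E₂` and bits `C_k = 1_{O_k} - 1_{Δ_k}` whose events are
determined by disjoint sets of pairs `F₁`, `F₂` with every domain edge of `F_k` inside `E_k`, and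
which have mean zero (`P(O_k) = P(Δ_k)`), the revealed bits are orthogonal:
`E[C₁ Y₁ C₂ Y₂] = 0` with `Y_k = 1_{Reveals hD E_k}`. This is the field `orthogonal` of
`GarbanScheme` (`FourArmGarbanAssembly.lean`). [cite: SchrammSmirnov2011, Appendix B, proof of Lemma B.1 (nondiagonal terms vanish)] -/
theorem integral_indicator_reveals_mul_eq_zero (hD : D.IsZdAdmissible) (p : unitInterval)
    {E₁ E₂ F₁ F₂ : Set (Sym2 (Site 2))} (hE : Disjoint E₁ E₂) (hF : Disjoint F₁ F₂)
    (hFE₁ : ∀ e ∈ F₁, e ∈ (discreteDomainGraph D.Ω D.δ).edgeSet → e ∈ E₁)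
    (hFE₂ : ∀ e ∈ F₂, e ∈ (discreteDomainGraph D.Ω D.δ).edgeSet → e ∈ E₂)
    {O₁ Δ₁ O₂ Δ₂ : Set (BondConfig (Site 2))}
    (hO₁ : DeterminedBy O₁ F₁) (hΔ₁ : DeterminedBy Δ₁ F₁)
    (hO₂ : DeterminedBy O₂ F₂) (hΔ₂ : DeterminedBy Δ₂ F₂)
    (hO₁m : MeasurableSet O₁) (hΔ₁m : MeasurableSet Δ₁)
    (hO₂m : MeasurableSet O₂) (hΔ₂m : MeasurableSet Δ₂)
    (h₁ : (bondPercolation (zdGraph 2) p).real O₁ = (bondPercolation (zdGraph 2) p).real Δ₁)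
    (h₂ : (bondPercolation (zdGraph 2) p).real O₂ = (bondPercolation (zdGraph 2) p).real Δ₂) :
    ∫ ω, (Reveals hD E₁).indicator
        (fun ω => O₁.indicator (1 : BondConfig (Site 2) → ℝ) ω - Δ₁.indicator 1 ω) ω *
      (Reveals hD E₂).indicator
        (fun ω => O₂.indicator (1 : BondConfig (Site 2) → ℝ) ω - Δ₂.indicator 1 ω) ω
      ∂(bondPercolation (zdGraph 2) p) = 0 := by
  set P := bondPercolation (zdGraph 2) p with hP
  -- (1) expand the integrand and integrate term by term
  simp_rw [indicator_bit_mul_indicator_bit]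
  set R := Reveals hD E₁ ∩ Reveals hD E₂ with hR
  have hRm : MeasurableSet R := (measurableSet_reveals hD E₁).inter (measurableSet_reveals hD E₂)
  have hint : ∀ Y : Set (BondConfig (Site 2)), MeasurableSet Y →
      Integrable ((R ∩ Y).indicator (1 : BondConfig (Site 2) → ℝ)) P := fun Y hY =>
    (integrable_const (1 : ℝ)).indicator (hRm.inter hY)
  have hI : ∀ Y : Set (BondConfig (Site 2)), MeasurableSet Y →
      ∫ ω, (R ∩ Y).indicator (1 : BondConfig (Site 2) → ℝ) ω ∂P = P.real (R ∩ Y) := fun Y hY =>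
    integral_indicator_one (hRm.inter hY)
  have hOO := hO₁m.inter hO₂m
  have hOΔ := hO₁m.inter hΔ₂m
  have hΔO := hΔ₁m.inter hO₂m
  have hΔΔ := hΔ₁m.inter hΔ₂m
  change ∫ ω, (((R ∩ (O₁ ∩ O₂)).indicator (1 : BondConfig (Site 2) → ℝ) -
      (R ∩ (O₁ ∩ Δ₂)).indicator (1 : BondConfig (Site 2) → ℝ) -
      (R ∩ (Δ₁ ∩ O₂)).indicator (1 : BondConfig (Site 2) → ℝ) +
      (R ∩ (Δ₁ ∩ Δ₂)).indicator (1 : BondConfig (Site 2) → ℝ) : BondConfig (Site 2) → ℝ) ω) ∂P = 0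
  rw [integral_add' (((hint _ hOO).sub (hint _ hOΔ)).sub (hint _ hΔO)) (hint _ hΔΔ),
    integral_sub' ((hint _ hOO).sub (hint _ hOΔ)) (hint _ hΔO),
    integral_sub' (hint _ hOO) (hint _ hOΔ), hI _ hOO, hI _ hOΔ, hI _ hΔO, hI _ hΔΔ]
  -- (2) split `R` according to who is hit first
  have hsplit : ∀ Y : Set (BondConfig (Site 2)), MeasurableSet Y →
      P.real (R ∩ Y) = P.real (VisitsBefore hD E₁ E₂ ∩ Y) + P.real (VisitsBefore hD E₂ E₁ ∩ Y) := by
    intro Y hY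
    rw [hR, reveals_inter_reveals_eq_union hD hE, union_inter_distrib_right]
    exact measureReal_union ((disjoint_visitsBefore hD E₁ E₂).mono inter_subset_left inter_subset_left)
      ((measurableSet_visitsBefore hD E₂ E₁).inter hY)
  rw [hsplit _ hOO, hsplit _ hOΔ, hsplit _ hΔO, hsplit _ hΔΔ]
  -- (3) independence: block `2` is fresh on `VisitsBefore E₁ E₂`, block `1` on `VisitsBefore E₂ E₁`
  have hA : ∀ {S X : Set (BondConfig (Site 2))}, DeterminedBy S F₁ → MeasurableSet S →
      DeterminedBy X F₂ → MeasurableSet X →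
      P.real (VisitsBefore hD E₁ E₂ ∩ (S ∩ X)) = P.real (VisitsBefore hD E₁ E₂ ∩ S) * P.real X := by
    intro S X hS hSm hX hXm
    rw [← inter_assoc]
    exact measureReal_visitsBefore_inter_inter hD p hF hFE₂ hS hSm hX hXm
  have hB : ∀ {S X : Set (BondConfig (Site 2))}, DeterminedBy S F₂ → MeasurableSet S →
      DeterminedBy X F₁ → MeasurableSet X →
      P.real (VisitsBefore hD E₂ E₁ ∩ (X ∩ S)) = P.real (VisitsBefore hD E₂ E₁ ∩ S) * P.real X := by
    intro S X hS hSm hX hXm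
    rw [inter_comm X S, ← inter_assoc]
    exact measureReal_visitsBefore_inter_inter hD p hF.symm hFE₁ hS hSm hX hXm
  rw [hA hO₁ hO₁m hO₂ hO₂m, hA hO₁ hO₁m hΔ₂ hΔ₂m, hA hΔ₁ hΔ₁m hO₂ hO₂m, hA hΔ₁ hΔ₁m hΔ₂ hΔ₂m,
    hB hO₂ hO₂m hO₁ hO₁m, hB hΔ₂ hΔ₂m hO₁ hO₁m, hB hO₂ hO₂m hΔ₁ hΔ₁m, hB hΔ₂ hΔ₂m hΔ₁ hΔ₁m,
    h₁, h₂]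
  ring

end Literature.Probability.Percolation
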